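import Mathlib
import Literature.Combinatorics.Additive.TripleProductProperty
import Summits.MatrixMultiplication.MatrixMultiplication.Theorems.HyperoctahedralThreshold.Negative.Census6Witness

/-!
# Witnesses for the TPP capacity of `S_4` and `S_5` (crux `PolynomialSlack`, small-`n` census)

`P(S_n) := max |S||T||U|` over TPP triples of subsets of `S_n` (TPP capacity `β(S_n)`, Hedtke–Murthy 2012);
`PolynomialSlack` asserts `P(S_n)·n^C ≤ (n!)^(3/2)` eventually for every `C`.  Certified lower bounds:
`P(S_4) ≥ 36` (the exact value, `= β(S_4)`), `P(S_5) ≥ 256` (`= β_g(S_5)`, subgroups `4·8·8`).  The TPP is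
checked through explicit quotient sets (`tpp_of_quot6` of `Census6Witness`, Cohn–Umans 2003, Def. 2.1) by evaluation.
-/

namespace Summit.MatrixMultiplication.MatrixMultiplication.Theorems.PolynomialSlack.Negative

set_option linter.dupNamespace false

open Literature.Combinatorics.Additive
open Summit.MatrixMultiplication.MatrixMultiplication.Theorems.HyperoctahedralThreshold.Negative (tpp_of_quot6)

/-- (`= β(S_4) = 36 = (3/2)|S_4|`, Hedtke–Murthy 2012 Table 1; `(4!)^(3/2) ≈ 117.6`, ratio 0.306.) Found by the SAT frontier of kit job j018287 (exact: 36 is also the certified maximum, L2). [cite: HedtkeMurthy2012, Table 1] -/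
theorem sn4_witness :
    ∃ S T U : Finset (Equiv.Perm (Fin 4)),
      TripleProductProperty S T U ∧ S.card * T.card * U.card = 36 := by
  refine ⟨([1, Equiv.swap (1 : Fin 4) 2, Equiv.swap (1 : Fin 4) 3] : List (Equiv.Perm (Fin 4))).toFinset,
    ([1, Equiv.swap (0 : Fin 4) 3 * Equiv.swap (0 : Fin 4) 2, Equiv.swap (0 : Fin 4) 2 * Equiv.swap (0 : Fin 4) 3] : List (Equiv.Perm (Fin 4))).toFinset,
    ([1, Equiv.swap (2 : Fin 4) 3, Equiv.swap (0 : Fin 4) 1, Equiv.swap (0 : Fin 4) 1 * Equiv.swap (2 : Fin 4) 3] : List (Equiv.Perm (Fin 4))).toFinset, ?_, by native_decide⟩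
  exact tpp_of_quot6
    ([1, Equiv.swap (1 : Fin 4) 2, Equiv.swap (1 : Fin 4) 3 * Equiv.swap (1 : Fin 4) 2, Equiv.swap (1 : Fin 4) 2 * Equiv.swap (1 : Fin 4) 3, Equiv.swap (1 : Fin 4) 3] : List (Equiv.Perm (Fin 4))).toFinset
    ([1, Equiv.swap (0 : Fin 4) 3 * Equiv.swap (0 : Fin 4) 2, Equiv.swap (0 : Fin 4) 2 * Equiv.swap (0 : Fin 4) 3] : List (Equiv.Perm (Fin 4))).toFinset
    ([1, Equiv.swap (2 : Fin 4) 3, Equiv.swap (0 : Fin 4) 1, Equiv.swap (0 : Fin 4) 1 * Equiv.swap (2 : Fin 4) 3] : List (Equiv.Perm (Fin 4))).toFinset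
    (by native_decide) (by native_decide) (by native_decide) (by native_decide)

/-- (a TPP triple of SUBGROUPS of orders 4, 8, 8 — the subgroup TPP capacity `β_g(S_5) = 256`, by enumeration of all 156 subgroups of `S_5` (ccert seat); `(5!)^(3/2) ≈ 1314.5`, ratio 0.195; whether SUBSETS beat 256 is the open part of the window.) [folklore] -/
theorem sn5_witness :
    ∃ S T U : Finset (Equiv.Perm (Fin 5)),
      TripleProductProperty S T U ∧ S.card * T.card * U.card = 256 := by
  refine ⟨([1, Equiv.swap (2 : Fin 5) 4, Equiv.swap (1 : Fin 5) 3, Equiv.swap (1 : Fin 5) 3 * Equiv.swap (2 : Fin 5) 4] : List (Equiv.Perm (Fin 5))).toFinset,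
    ([1, Equiv.swap (3 : Fin 5) 4, Equiv.swap (0 : Fin 5) 1, Equiv.swap (0 : Fin 5) 1 * Equiv.swap (3 : Fin 5) 4, Equiv.swap (0 : Fin 5) 3 * Equiv.swap (1 : Fin 5) 4, Equiv.swap (0 : Fin 5) 4 * Equiv.swap (0 : Fin 5) 1 * Equiv.swap (0 : Fin 5) 3, Equiv.swap (0 : Fin 5) 3 * Equiv.swap (0 : Fin 5) 1 * Equiv.swap (0 : Fin 5) 4, Equiv.swap (0 : Fin 5) 4 * Equiv.swap (1 : Fin 5) 3] : List (Equiv.Perm (Fin 5))).toFinset,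
    ([1, Equiv.swap (1 : Fin 5) 2, Equiv.swap (0 : Fin 5) 1 * Equiv.swap (2 : Fin 5) 3, Equiv.swap (0 : Fin 5) 2 * Equiv.swap (0 : Fin 5) 3 * Equiv.swap (0 : Fin 5) 1, Equiv.swap (0 : Fin 5) 1 * Equiv.swap (0 : Fin 5) 3 * Equiv.swap (0 : Fin 5) 2, Equiv.swap (0 : Fin 5) 2 * Equiv.swap (1 : Fin 5) 3, Equiv.swap (0 : Fin 5) 3, Equiv.swap (0 : Fin 5) 3 * Equiv.swap (1 : Fin 5) 2] : List (Equiv.Perm (Fin 5))).toFinset, ?_, by native_decide⟩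
  exact tpp_of_quot6
    ([1, Equiv.swap (2 : Fin 5) 4, Equiv.swap (1 : Fin 5) 3, Equiv.swap (1 : Fin 5) 3 * Equiv.swap (2 : Fin 5) 4] : List (Equiv.Perm (Fin 5))).toFinset
    ([1, Equiv.swap (3 : Fin 5) 4, Equiv.swap (0 : Fin 5) 1, Equiv.swap (0 : Fin 5) 1 * Equiv.swap (3 : Fin 5) 4, Equiv.swap (0 : Fin 5) 3 * Equiv.swap (1 : Fin 5) 4, Equiv.swap (0 : Fin 5) 4 * Equiv.swap (0 : Fin 5) 1 * Equiv.swap (0 : Fin 5) 3, Equiv.swap (0 : Fin 5) 3 * Equiv.swap (0 : Fin 5) 1 * Equiv.swap (0 : Fin 5) 4, Equiv.swap (0 : Fin 5) 4 * Equiv.swap (1 : Fin 5) 3] : List (Equiv.Perm (Fin 5))).toFinset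
    ([1, Equiv.swap (1 : Fin 5) 2, Equiv.swap (0 : Fin 5) 1 * Equiv.swap (2 : Fin 5) 3, Equiv.swap (0 : Fin 5) 2 * Equiv.swap (0 : Fin 5) 3 * Equiv.swap (0 : Fin 5) 1, Equiv.swap (0 : Fin 5) 1 * Equiv.swap (0 : Fin 5) 3 * Equiv.swap (0 : Fin 5) 2, Equiv.swap (0 : Fin 5) 2 * Equiv.swap (1 : Fin 5) 3, Equiv.swap (0 : Fin 5) 3, Equiv.swap (0 : Fin 5) 3 * Equiv.swap (1 : Fin 5) 2] : List (Equiv.Perm (Fin 5))).toFinset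
    (by native_decide) (by native_decide) (by native_decide) (by native_decide)

end Summit.MatrixMultiplication.MatrixMultiplication.Theorems.PolynomialSlack.Negative
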